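import Summits.QuantumFields.YangMills.Theorems.ConvexGribovBodyNonSimplyConnectedLatticeGapStubSectorMixture
import HarnessLib

/-!
# Crux `NonSimplyConnectedLatticeGap` (stmt-QuantumFields-16405), route `ConvexGribovBody`,
# line `twist-equipartition-blindness` — MIX in its v2 shape, from the landed core `mix_core`

Reduction file 1/3 of the line (line card `Cruxes/NonSimplyConnectedLatticeGap/Lines/twist-equipartition-blindness.md`,
skeleton `Cruxes/NonSimplyConnectedLatticeGap/Lines/twist_equipartition_blindness.lean`, §2). The line reads the
periodic `(G, r)` Wilson theory of a compact simple `G` with `π₁(G) ≠ 0` as the `(H, r∘π)` theory of its universal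
cover `π : H →* G` and splits the `H`-side configuration space, off a rare bad event, into the 't Hooft flux
sectors of an interface labelling family `cls S : GaugeConfig 4 (2S+1) H → Option (planes → ker π)`.

MIX is the bookkeeping step: small bad event + per-sector clustering (PSC) + ELECTRIC twist equipartition
(EQUI) + ELECTRIC blindness (EBLIND) at `β` give the volume-uniform clustering body at `β` on pulled-back local
observables. Its v1 form `stub_sectorMixture` is LANDED (`…StubSectorMixture.lean`, over the generic core
`mix_core`). The v2 form proved here, `twist_sectorMixture_of_core`, weakens the equipartition hypothesis to the
tori `S ≥ S_e` (`S_e` chosen after `β`): after the wave-1 audit EQUI was reshaped, because at small badness `a`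
the smallest tori may have EMPTY electric sectors next to non-empty ones, so no `S`-uniform multiplicative
comparability of sector weights can hold. The statement is the text of the skeleton's §0 proposition
`SectorMixture`, inline.

Derivation (no new analysis): apply `mix_core` to the modified labelling `cls' S V := if S_e ≤ S then cls S V
else none` — it keeps measurable fibres (X_m), translation invariance (X6) and axis exchange (X5, same `σ, Ψ`),
its unlabelled set below `S_e` is everything (absorbed into the bad-event constant `max C e^{c S_e}`, the Wilson
state being a probability measure), every sector hypothesis below `S_e` holds trivially on EMPTY sectors, and
the conclusion does not mention the labelling.
-/

set_option autoImplicit false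

namespace Summit.QuantumFields.YangMills.Theorems.NonSimplyConnectedLatticeGap

/-- **MIX, v2 shape (equipartition only on the tori `S ≥ S_e`), from the landed core `mix_core`.** For every
cover datum `(G, H, π, ρH, r)` of the line's common context, every badness `a`, coupling `β` and interface
labelling family `cls` (eight clauses X_m, X0–X6, X5): exponentially small bad event + per-sector clustering of
pulled-back local observables (junk-safe, `n ≤ S`) + electric twist equipartition from some `S_e` on + electric
blindness imply the clustering body `∃ m > 0, ∃ S₁, ∀ A B, ∃ C, ∀ S n, S₁ ≤ S → n ≤ S →
|latticeConnectedCorr (r.ρ.comp π) β (2S+1) Ã B̃ n| ≤ C e^{−mn}`. This is the skeleton's §0 proposition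
`SectorMixture` of line `twist-equipartition-blindness` (crux `NonSimplyConnectedLatticeGap`,
stmt-QuantumFields-16405), verbatim; proof: `mix_core` (landed stub MIX, v1) applied to the truncated labelling
`fun S V => if S_e ≤ S then cls S V else none`. -/
theorem twist_sectorMixture_of_core :
    ∀ (G : Type) [Group G] [TopologicalSpace G] [IsTopologicalGroup G] [CompactSpace G] [MeasurableSpace G] [BorelSpace
    G], Literature.MathematicalPhysics.QuantumFieldTheory.IsCompactSimpleLieGroup G → ∀ (H : Type) [Group H]
    [TopologicalSpace H] [IsTopologicalGroup H] [CompactSpace H] [MeasurableSpace H] [BorelSpace H],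
    Literature.MathematicalPhysics.QuantumFieldTheory.IsCompactSimpleLieGroup H → SimplyConnectedSpace H → ∀ (π : H →*
    G), Continuous π → Function.Surjective π → π.ker ≤ Subgroup.center H → (π.ker : Set H).Finite → π.ker ≠ ⊥ → ∀ (ρH
    : Literature.MathematicalPhysics.QuantumFieldTheory.LatticeRep H) (r :
    Literature.MathematicalPhysics.QuantumFieldTheory.LatticeRep G), ∀ (a β : ℝ) (cls : ∀ S : ℕ,
    Literature.MathematicalPhysics.QuantumFieldTheory.GaugeConfig 4 (2 * S + 1) H → Option ({p : Fin 4 × Fin 4 // p.1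
    < p.2} → ↥π.ker)), (∀ S : ℕ, ((∀ o : Option ({p : Fin 4 × Fin 4 // p.1 < p.2} → ↥π.ker), MeasurableSet ((cls S) ⁻¹'
    {o})) ∧ (∀ V : Literature.MathematicalPhysics.QuantumFieldTheory.GaugeConfig 4 (2 * S + 1) H, (cls S) V = none ↔
    (S < 64 ∨ ∃ (k : ℕ) (ch : Fin (k + 1) → Literature.MathematicalPhysics.QuantumFieldTheory.Plaquette 4 (2 * S +
    1)), (∀ i, a ≤ (r.N : ℝ) - ((r.ρ.comp π) (Literature.MathematicalPhysics.QuantumFieldTheory.plaquetteHolonomy V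
    (ch i).1 (ch i).2.1.1 (ch i).2.1.2)).trace.re) ∧ (∀ i : Fin k, (Finset.univ.sup fun j : Fin 4 => (((ch
    i.castSucc).1 j - (ch i.succ).1 j).valMinAbs).natAbs) ≤ 3) ∧ S ≤ 16 * (Finset.univ.sup fun j : Fin 4 => (((ch 0).1
    j - (ch (Fin.last k)).1 j).valMinAbs).natAbs))) ∧ (∀ (ε : Literature.MathematicalPhysics.QuantumFieldTheory.Edge 4
    (2 * S + 1) → ↥π.ker) (V : Literature.MathematicalPhysics.QuantumFieldTheory.GaugeConfig 4 (2 * S + 1) H), (cls S)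
    (fun e => ((ε e : ↥π.ker) : H) * V e) = (cls S) V) ∧ (∀ (g :
    Literature.MathematicalPhysics.QuantumFieldTheory.Site 4 (2 * S + 1) → H) (V :
    Literature.MathematicalPhysics.QuantumFieldTheory.GaugeConfig 4 (2 * S + 1) H), (cls S)
    (Literature.MathematicalPhysics.QuantumFieldTheory.gaugeTransform g V) = (cls S) V) ∧ (∀ (v :
    Literature.MathematicalPhysics.QuantumFieldTheory.Site 4 (2 * S + 1)) (V :
    Literature.MathematicalPhysics.QuantumFieldTheory.GaugeConfig 4 (2 * S + 1) H), (cls S) (fun e => V (e.1 + v,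
    e.2)) = (cls S) V) ∧ (∀ (V V' : Literature.MathematicalPhysics.QuantumFieldTheory.GaugeConfig 4 (2 * S + 1) H) (x₀
    : Literature.MathematicalPhysics.QuantumFieldTheory.Site 4 (2 * S + 1)), (∀ e :
    Literature.MathematicalPhysics.QuantumFieldTheory.Edge 4 (2 * S + 1), S < 16 * (Finset.univ.sup fun j : Fin 4 =>
    ((e.1 j - x₀ j).valMinAbs).natAbs) → V e = V' e) → (cls S) V ≠ none → (cls S) V' ≠ none → (cls S) V = (cls S) V')
    ∧ (∀ (z : {p : Fin 4 × Fin 4 // p.1 < p.2} → ↥π.ker) (ε : Literature.MathematicalPhysics.QuantumFieldTheory.Edge 4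
    (2 * S + 1) → ↥π.ker) (V : Literature.MathematicalPhysics.QuantumFieldTheory.GaugeConfig 4 (2 * S + 1) H), (∀ p :
    Literature.MathematicalPhysics.QuantumFieldTheory.Plaquette 4 (2 * S + 1), (∀ k' : H, k' ∈ π.ker → k' ≠ ((if p.1
    p.2.1.1 = 0 ∧ p.1 p.2.1.2 = 0 then ((z p.2 : ↥π.ker) : H) else (1 : H)) *
    Literature.MathematicalPhysics.QuantumFieldTheory.plaquetteHolonomy (fun e => ((ε e : ↥π.ker) : H)) p.1 p.2.1.1
    p.2.1.2) → (ρH.ρ (k'⁻¹ * Literature.MathematicalPhysics.QuantumFieldTheory.plaquetteHolonomy V p.1 p.2.1.1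
    p.2.1.2)).trace.re < (ρH.ρ ((((if p.1 p.2.1.1 = 0 ∧ p.1 p.2.1.2 = 0 then ((z p.2 : ↥π.ker) : H) else (1 : H)) *
    Literature.MathematicalPhysics.QuantumFieldTheory.plaquetteHolonomy (fun e => ((ε e : ↥π.ker) : H)) p.1 p.2.1.1
    p.2.1.2))⁻¹ * Literature.MathematicalPhysics.QuantumFieldTheory.plaquetteHolonomy V p.1 p.2.1.1
    p.2.1.2)).trace.re)) → (cls S) V = none ∨ (cls S) V = some z) ∧ (∀ q : {p : Fin 4 × Fin 4 // p.1 < p.2}, q.1.1 ≠ 0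
    → ∃ (σ : Equiv.Perm (Fin 4)) (Ψ : ({p : Fin 4 × Fin 4 // p.1 < p.2} → ↥π.ker) → ({p : Fin 4 × Fin 4 // p.1 < p.2}
    → ↥π.ker)), Function.Injective Ψ ∧ (∀ V : Literature.MathematicalPhysics.QuantumFieldTheory.GaugeConfig 4 (2 * S +
    1) H, (cls S) (Literature.MathematicalPhysics.QuantumFieldTheory.configPerm σ V) = ((cls S) V).map Ψ) ∧ (∀ z w :
    {p : Fin 4 × Fin 4 // p.1 < p.2} → ↥π.ker, (∀ q' : {p : Fin 4 × Fin 4 // p.1 < p.2}, q' ≠ q → z q' = w q') → ∀ q''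
    : {p : Fin 4 × Fin 4 // p.1 < p.2}, q''.1.1 ≠ 0 → Ψ z q'' = Ψ w q'')))) → (∃ c : ℝ, 0 < c ∧ ∃ C : ℝ, ∀ S : ℕ,
    ((Literature.MathematicalPhysics.QuantumFieldTheory.wilsonMeasure (r.ρ.comp π) β : MeasureTheory.Measure
    (Literature.MathematicalPhysics.QuantumFieldTheory.GaugeConfig 4 (2 * S + 1) H)) ((cls S) ⁻¹' {none})).toReal ≤ C
    * Real.exp (-(c * S))) → (∃ m : ℝ, 0 < m ∧ ∀ A B : Literature.MathematicalPhysics.QuantumFieldTheory.YMSpecies G,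
    ∃ C : ℝ, ∀ (S n : ℕ) (z : {p : Fin 4 × Fin 4 // p.1 < p.2} → ↥π.ker), n ≤ S → |(∫ V in ((cls S) ⁻¹' {some z}), A.F
    (fun e => π (Literature.MathematicalPhysics.QuantumLattice.torusLift (2 * S + 1) V e)) * B.F (fun e => π
    (Literature.MathematicalPhysics.QuantumLattice.configShift (-Pi.single 0 (n : ℤ))
    (Literature.MathematicalPhysics.QuantumLattice.torusLift (2 * S + 1) V) e))
    ∂(Literature.MathematicalPhysics.QuantumFieldTheory.wilsonMeasure (r.ρ.comp π) β : MeasureTheory.Measure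
    (Literature.MathematicalPhysics.QuantumFieldTheory.GaugeConfig 4 (2 * S + 1) H))) -
    (((Literature.MathematicalPhysics.QuantumFieldTheory.wilsonMeasure (r.ρ.comp π) β : MeasureTheory.Measure
    (Literature.MathematicalPhysics.QuantumFieldTheory.GaugeConfig 4 (2 * S + 1) H)) ((cls S) ⁻¹' {some z})).toReal)⁻¹
    * (∫ V in ((cls S) ⁻¹' {some z}), A.F (fun e => π (Literature.MathematicalPhysics.QuantumLattice.torusLift (2 * S
    + 1) V e)) ∂(Literature.MathematicalPhysics.QuantumFieldTheory.wilsonMeasure (r.ρ.comp π) β :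
    MeasureTheory.Measure (Literature.MathematicalPhysics.QuantumFieldTheory.GaugeConfig 4 (2 * S + 1) H))) * (∫ V in
    ((cls S) ⁻¹' {some z}), B.F (fun e => π (Literature.MathematicalPhysics.QuantumLattice.configShift (-Pi.single 0
    (n : ℤ)) (Literature.MathematicalPhysics.QuantumLattice.torusLift (2 * S + 1) V) e))
    ∂(Literature.MathematicalPhysics.QuantumFieldTheory.wilsonMeasure (r.ρ.comp π) β : MeasureTheory.Measure
    (Literature.MathematicalPhysics.QuantumFieldTheory.GaugeConfig 4 (2 * S + 1) H)))| ≤ C * Real.exp (-(m * n)) *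
    ((Literature.MathematicalPhysics.QuantumFieldTheory.wilsonMeasure (r.ρ.comp π) β : MeasureTheory.Measure
    (Literature.MathematicalPhysics.QuantumFieldTheory.GaugeConfig 4 (2 * S + 1) H)) ((cls S) ⁻¹' {some z})).toReal) →
    (∃ μ : ℝ, 0 < μ ∧ ∃ (S_e : ℕ) (C : ℝ), ∀ (S : ℕ) (z w : {p : Fin 4 × Fin 4 // p.1 < p.2} → ↥π.ker), S_e ≤ S →
    (∀ q : {p : Fin 4 × Fin 4 // p.1 < p.2}, q.1.1 ≠ 0 → z q = w q) → |((Literature.MathematicalPhysics.QuantumFieldTheory.wilsonMeasure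
    (r.ρ.comp π) β : MeasureTheory.Measure (Literature.MathematicalPhysics.QuantumFieldTheory.GaugeConfig 4 (2 * S +
    1) H)) ((cls S) ⁻¹' {some z})).toReal - ((Literature.MathematicalPhysics.QuantumFieldTheory.wilsonMeasure
    (r.ρ.comp π) β : MeasureTheory.Measure (Literature.MathematicalPhysics.QuantumFieldTheory.GaugeConfig 4 (2 * S +
    1) H)) ((cls S) ⁻¹' {some w})).toReal| ≤ C * Real.exp (-(μ * (2 * (S : ℝ) + 1))) *
    ((Literature.MathematicalPhysics.QuantumFieldTheory.wilsonMeasure (r.ρ.comp π) β : MeasureTheory.Measure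
    (Literature.MathematicalPhysics.QuantumFieldTheory.GaugeConfig 4 (2 * S + 1) H)) ((cls S) ⁻¹' {some w})).toReal) →
    (∃ μ : ℝ, 0 < μ ∧ ∀ A : Literature.MathematicalPhysics.QuantumFieldTheory.YMSpecies G, ∃ C : ℝ, ∀ (S : ℕ) (z w :
    {p : Fin 4 × Fin 4 // p.1 < p.2} → ↥π.ker), (∀ q : {p : Fin 4 × Fin 4 // p.1 < p.2}, q.1.1 ≠ 0 → z q = w q) → |((Literature.MathematicalPhysics.QuantumFieldTheory.wilsonMeasure
    (r.ρ.comp π) β : MeasureTheory.Measure (Literature.MathematicalPhysics.QuantumFieldTheory.GaugeConfig 4 (2 * S +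
    1) H)) ((cls S) ⁻¹' {some w})).toReal * (∫ V in ((cls S) ⁻¹' {some z}), A.F (fun e => π
    (Literature.MathematicalPhysics.QuantumLattice.torusLift (2 * S + 1) V e))
    ∂(Literature.MathematicalPhysics.QuantumFieldTheory.wilsonMeasure (r.ρ.comp π) β : MeasureTheory.Measure
    (Literature.MathematicalPhysics.QuantumFieldTheory.GaugeConfig 4 (2 * S + 1) H))) -
    ((Literature.MathematicalPhysics.QuantumFieldTheory.wilsonMeasure (r.ρ.comp π) β : MeasureTheory.Measure
    (Literature.MathematicalPhysics.QuantumFieldTheory.GaugeConfig 4 (2 * S + 1) H)) ((cls S) ⁻¹' {some z})).toReal *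
    (∫ V in ((cls S) ⁻¹' {some w}), A.F (fun e => π (Literature.MathematicalPhysics.QuantumLattice.torusLift (2 * S +
    1) V e)) ∂(Literature.MathematicalPhysics.QuantumFieldTheory.wilsonMeasure (r.ρ.comp π) β : MeasureTheory.Measure
    (Literature.MathematicalPhysics.QuantumFieldTheory.GaugeConfig 4 (2 * S + 1) H)))| ≤ C * Real.exp (-(μ * (2 * (S :
    ℝ) + 1))) * ((Literature.MathematicalPhysics.QuantumFieldTheory.wilsonMeasure (r.ρ.comp π) β :
    MeasureTheory.Measure (Literature.MathematicalPhysics.QuantumFieldTheory.GaugeConfig 4 (2 * S + 1) H)) ((cls S) ⁻¹'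
    {some z})).toReal * ((Literature.MathematicalPhysics.QuantumFieldTheory.wilsonMeasure (r.ρ.comp π) β :
    MeasureTheory.Measure (Literature.MathematicalPhysics.QuantumFieldTheory.GaugeConfig 4 (2 * S + 1) H)) ((cls S) ⁻¹'
    {some w})).toReal) → (∃ m : ℝ, 0 < m ∧ ∃ S₁ : ℕ, ∀ A B :
    Literature.MathematicalPhysics.QuantumFieldTheory.YMSpecies G, ∃ C : ℝ, ∀ S n : ℕ, S₁ ≤ S → n ≤ S → |Literature.MathematicalPhysics.QuantumFieldTheory.latticeConnectedCorr
    (r.ρ.comp π) β (2 * S + 1) (fun V => A.F (fun e => π (V e))) (fun V => B.F (fun e => π (V e))) n| ≤ C * Real.exp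
    (-(m * n))) := by
  intro G _ _ _ _ _ _ _hG H _ _ _ _ _ _ _hH _hsc π hπc _hπs _hker hfin _hnt _ρH r a β cls hI hbad hpsc hequi
    heblind
  classical
  haveI : Fintype ↥π.ker := @Fintype.ofFinite _ hfin.to_subtype
  have hρc : Continuous (r.ρ.comp π) := r.continuous.comp hπc
  obtain ⟨μ₁, hμ₁, S_e, C₁, hC₁⟩ := hequi
  obtain ⟨c, hc, Cb, hCb⟩ := hbad
  obtain ⟨m, hm, hP⟩ := hpsc
  obtain ⟨μ₂, hμ₂, hE⟩ := heblind
  -- the modified labelling agrees with `cls` from `S_e` on and has empty sectors below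
  have hon : ∀ S : ℕ, S_e ≤ S →
      (fun V : Literature.MathematicalPhysics.QuantumFieldTheory.GaugeConfig 4 (2 * S + 1) H =>
        if S_e ≤ S then cls S V else none) = cls S :=
    fun S hS => funext fun V => if_pos hS
  have hoff : ∀ S : ℕ, ¬ S_e ≤ S → ∀ z : {p : Fin 4 × Fin 4 // p.1 < p.2} → ↥π.ker,
      (fun V : Literature.MathematicalPhysics.QuantumFieldTheory.GaugeConfig 4 (2 * S + 1) H =>
        if S_e ≤ S then cls S V else none) ⁻¹' {some z} = ∅ :=
    fun S hS z => Set.eq_empty_of_forall_notMem fun V hV => by simp [if_neg hS] at hV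
  refine mix_core π hπc (r.ρ.comp π) hρc β
    (fun (S : ℕ) (V : Literature.MathematicalPhysics.QuantumFieldTheory.GaugeConfig 4 (2 * S + 1) H) =>
      if S_e ≤ S then cls S V else none)
    (fun S => (Literature.MathematicalPhysics.QuantumFieldTheory.wilsonMeasure (r.ρ.comp π) β :
      MeasureTheory.Measure (Literature.MathematicalPhysics.QuantumFieldTheory.GaugeConfig 4 (2 * S + 1) H)))
    (fun _ => rfl) ?_ ?_ ?_ ?_ ?_ ?_ ?_
  · -- X_m
    intro S o
    by_cases hS : S_e ≤ S
    · rw [hon S hS]; exact (hI S).1 o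
    · simp only [if_neg hS]
      exact MeasurableSet.const _
  · -- X6
    intro S v V
    by_cases hS : S_e ≤ S
    · simp only [if_pos hS]; exact (hI S).2.2.2.2.1 v V
    · simp only [if_neg hS]
  · -- X5
    intro S q hq
    obtain ⟨σ, Ψ, hΨ, hperm, hrel⟩ := (hI S).2.2.2.2.2.2.2 q hq
    refine ⟨σ, Ψ, hΨ, fun V => ?_, hrel⟩
    by_cases hS : S_e ≤ S
    · simp only [if_pos hS]; exact hperm V
    · simp only [if_neg hS, Option.map_none]
  · -- bad event: below `S_e` everything is unlabelled, absorbed into the constant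
    refine ⟨c, hc, max Cb (Real.exp (c * S_e)), fun S => ?_⟩
    by_cases hS : S_e ≤ S
    · rw [hon S hS]
      exact (hCb S).trans (mul_le_mul_of_nonneg_right (le_max_left _ _) (Real.exp_nonneg _))
    · haveI := Literature.MathematicalPhysics.QuantumFieldTheory.isProbabilityMeasure_wilsonMeasure
        (d := 4) (L := 2 * S + 1) (r.ρ.comp π) hρc β
      have h1 : ((Literature.MathematicalPhysics.QuantumFieldTheory.wilsonMeasure (r.ρ.comp π) β :
          MeasureTheory.Measure (Literature.MathematicalPhysics.QuantumFieldTheory.GaugeConfig 4 (2 * S + 1) H))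
          ((fun V : Literature.MathematicalPhysics.QuantumFieldTheory.GaugeConfig 4 (2 * S + 1) H =>
            if S_e ≤ S then cls S V else none) ⁻¹' {none})).toReal ≤ 1 :=
        (ENNReal.toReal_mono ENNReal.one_ne_top MeasureTheory.prob_le_one).trans_eq ENNReal.toReal_one
      have h2 : (1 : ℝ) ≤ Real.exp (c * S_e) * Real.exp (-(c * S)) := by
        rw [← Real.exp_add]
        refine Real.one_le_exp ?_
        have : (S : ℝ) ≤ S_e := by exact_mod_cast (not_le.1 hS).le
        nlinarith
      exact h1.trans (h2.trans (mul_le_mul_of_nonneg_right (le_max_right _ _) (Real.exp_nonneg _)))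
  · -- per-sector clustering: empty sectors below `S_e`
    refine ⟨m, hm, fun A B => ?_⟩
    obtain ⟨C, hC⟩ := hP A B
    refine ⟨C, fun S n z hn => ?_⟩
    by_cases hS : S_e ≤ S
    · rw [hon S hS]; exact hC S n z hn
    · rw [hoff S hS z]; simp
  · -- electric equipartition: given from `S_e` on, trivial on empty sectors below
    refine ⟨μ₁, hμ₁, C₁, fun S z w hzw => ?_⟩
    by_cases hS : S_e ≤ S
    · rw [hon S hS]; exact hC₁ S z w hS hzw
    · rw [hoff S hS z, hoff S hS w]; simp
  · -- electric blindness
    refine ⟨μ₂, hμ₂, fun A => ?_⟩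
    obtain ⟨C, hC⟩ := hE A
    refine ⟨C, fun S z w hzw => ?_⟩
    by_cases hS : S_e ≤ S
    · rw [hon S hS]; exact hC S z w hzw
    · rw [hoff S hS z, hoff S hS w]; simp

end Summit.QuantumFields.YangMills.Theorems.NonSimplyConnectedLatticeGap
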